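import Literature.NumberTheory.EllipticCurves.ZpCorankQuasiIso
import HarnessLib

/-!
# Finite-index (Herbrand-quotient) calculus, I: the six-term count for a map of short exact sequences
# (cell `bsd-eis`, seat `bsd-line-x1-p1` LEAD g4; crux 2 `GoodLatticeBDPValue`, line `halves`, V21 index road §2 (1)–(3))

HONEST FRAMING (cell `bsd-eis`, run/shared/lean/pub/bsd-eis/): pure homological algebra of abelian groups (no definition,
no named fact, no `sorry`, no `Theses` import); nothing about any curve is asserted; BSD and the main conjectures are
proved for NO curve. Helper `--supports stmt-BirchSwinnertonDyer-19032`; closes no registered stub.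

## Why

The V21 road (`Cruxes/GoodLatticeBDPValue/Lines/halves-imprimLambda-index-road.md`) proves Keller–Yin Thm. 1.4.1 (iii) by
bookkeeping with the "index" `ind T = d ker T − d coker T` (Herbrand quotient `#ker T / #coker T`) of homomorphisms of
abelian groups with finite kernel and cokernel between INFINITE groups (`H¹(K_Σ/K_∞, E[p])`, `⊕_w H¹(K_{∞,w}, E[p])`, …). This
file supplies the one tool everything else reduces to: for a commutative diagram of abelian groups with short exact rows
`0 → M₁ → M₂ → M₃ → 0`, `0 → N₁ → N₂ → N₃ → 0` and vertical maps `i₁, i₂, i₃`, the snake lemma gives a six-term exact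
sequence `0 → ker i₁ → ker i₂ → ker i₃ → coker i₁ → coker i₂ → coker i₃ → 0`; when the six corners are finite,
**`#ker i₁ · #ker i₃ · #coker i₂ = #ker i₂ · #coker i₁ · #coker i₃`** (`natCard_snake`). The corners are presented
abstractly (injections `ι_k` exact with `i_k`, surjections `π_k` exact after `i_k`, the induced maps `F₁, F₂, G₁, G₂`
supplied by the caller), as in Mathlib's `Mathlib.Algebra.Module.SnakeLemma`, whose connecting map `SnakeLemma.δ'` and
exactness lemmas `exact_δ'_right/left` are used; the outer exactness statements and the count are proved here. Corollary
(`natCard_ker_mul_of_surjective`, road step (2), the "quotient rule"): if `ℓ ∘ κ = κ' ∘ ρ` with `κ, κ'` surjective with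
finite kernels, then `#ker ρ · #coker ℓ · #ker κ' = #ker ℓ · #coker ρ · #ker κ`. Also `finite_of_exact`.

References: [SerreGaloisCohomology1997] I §2; [MilneADT2006] I §2 (Herbrand quotients); Mathlib `Algebra/Module/SnakeLemma`;
tree `ZpCorankQuasiIso` (`natCard_torsionBy_snake`, the template); [KellerYin2024] §1.4 (the consumer).
-/

set_option autoImplicit false
set_option linter.dupNamespace false -- the summit namespace `…BirchSwinnertonDyer.BirchSwinnertonDyer.Theorems` (Sub = Summit, D-0017) trips it

noncomputable section

open Function

namespace Summit.BirchSwinnertonDyer.BirchSwinnertonDyer.Theorems.FiniteIndexCalculus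

/-! ## §0 Counting along exact pairs -/

/-- `#B = #im φ · #im ψ` for an exact pair `A →φ B →ψ C` with `B` finite. [folklore] -/
theorem natCard_eq_of_exact {α β γ : Type*} [AddCommGroup α] [AddCommGroup β] [AddCommGroup γ]
    [Finite β] (φ : α →+ β) (ψ : β →+ γ) (h : Exact φ ψ) :
    Nat.card β = Nat.card φ.range * Nat.card ψ.range := by
  rw [Literature.NumberTheory.EllipticCurves.natCard_eq_card_ker_mul_card_range ψ, h.addMonoidHom_ker_eq]

/-- The middle term of an exact pair `A →φ B →ψ C` with `A` and `C` finite is finite. [folklore] -/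
theorem finite_of_exact {α β γ : Type*} [AddCommGroup α] [AddCommGroup β] [AddCommGroup γ]
    [Finite α] [Finite γ] (φ : α →+ β) (ψ : β →+ γ) (h : Exact φ ψ) : Finite β := by
  haveI : Finite φ.range := Finite.of_surjective _ φ.rangeRestrict_surjective
  haveI : Finite ψ.ker := by rw [h.addMonoidHom_ker_eq]; infer_instance
  haveI : Finite (β ⧸ ψ.ker) :=
    Finite.of_equiv _ (QuotientAddGroup.quotientKerEquivRange ψ).symm.toEquiv
  exact Finite.of_addSubgroup_quotient ψ.ker

/-- `#im φ = #A` for `φ` injective. [folklore] -/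
theorem natCard_range_of_injective {α β : Type*} [AddCommGroup α] [AddCommGroup β] (φ : α →+ β)
    (hφ : Injective φ) : Nat.card φ.range = Nat.card α :=
  (Nat.card_congr (AddMonoidHom.ofInjective hφ).toEquiv).symm

/-- `#im ψ = #C` for `ψ` surjective. [folklore] -/
theorem natCard_range_of_surjective {β γ : Type*} [AddCommGroup β] [AddCommGroup γ] (ψ : β →+ γ)
    (hψ : Surjective ψ) : Nat.card ψ.range = Nat.card γ := by
  rw [AddMonoidHom.range_eq_top.2 hψ, AddSubgroup.card_top]

/-- The kernel presented by its inclusion: `ker t ↪ A →t B` is exact. [folklore] -/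
theorem exact_ker_subtype {α β : Type*} [AddCommGroup α] [AddCommGroup β] (t : α →+ β) :
    Exact t.ker.subtype t := fun a ↦
  ⟨fun ha ↦ ⟨⟨a, ha⟩, rfl⟩, by rintro ⟨b, rfl⟩; exact b.2⟩

/-- The cokernel presented by the quotient map: `A →t B ↠ B ⧸ im t` is exact. [folklore] -/
theorem exact_mk'_range {α β : Type*} [AddCommGroup α] [AddCommGroup β] (t : α →+ β) :
    Exact t (QuotientAddGroup.mk' t.range) := fun b ↦ by
  rw [QuotientAddGroup.mk'_apply, QuotientAddGroup.eq_zero_iff]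
  exact ⟨fun ⟨a, ha⟩ ↦ ⟨a, ha⟩, fun ⟨a, ha⟩ ↦ ⟨a, ha⟩⟩

/-! ## §1 The six-term count -/

section Snake

variable {M₁ M₂ M₃ N₁ N₂ N₃ K₁ K₂ K₃ C₁ C₂ C₃ : Type*}
  [AddCommGroup M₁] [AddCommGroup M₂] [AddCommGroup M₃]
  [AddCommGroup N₁] [AddCommGroup N₂] [AddCommGroup N₃]
  [AddCommGroup K₁] [AddCommGroup K₂] [AddCommGroup K₃]
  [AddCommGroup C₁] [AddCommGroup C₂] [AddCommGroup C₃]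
  {f₁ : M₁ →+ M₂} {f₂ : M₂ →+ M₃} {g₁ : N₁ →+ N₂} {g₂ : N₂ →+ N₃}
  {i₁ : M₁ →+ N₁} {i₂ : M₂ →+ N₂} {i₃ : M₃ →+ N₃}
  {ι₁ : K₁ →+ M₁} {ι₂ : K₂ →+ M₂} {ι₃ : K₃ →+ M₃}
  {π₁ : N₁ →+ C₁} {π₂ : N₂ →+ C₂} {π₃ : N₃ →+ C₃}
  {F₁ : K₁ →+ K₂} {F₂ : K₂ →+ K₃} {G₁ : C₁ →+ C₂} {G₂ : C₂ →+ C₃}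

/-- Exactness of `0 → ker i₁ → ker i₂`: the map induced on kernels by an injective `f₁` is injective. [folklore] -/
theorem injective_kerMap (hf₁ : Injective f₁) (hι₁ : Injective ι₁) (hF₁ : ∀ k, ι₂ (F₁ k) = f₁ (ι₁ k)) :
    Injective F₁ := by
  intro a b hab
  apply hι₁
  apply hf₁
  rw [← hF₁, ← hF₁, hab]

/-- Exactness of `ker i₁ → ker i₂ → ker i₃` (diagram chase; uses `g₁` injective). [folklore] -/
theorem exact_kerMap (hf : Exact f₁ f₂) (hg₁ : Injective g₁) (h₁ : ∀ x, g₁ (i₁ x) = i₂ (f₁ x))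
    (hι₁ : Exact ι₁ i₁) (hι₂ : Exact ι₂ i₂) (hι₂i : Injective ι₂) (hι₃i : Injective ι₃)
    (hF₁ : ∀ k, ι₂ (F₁ k) = f₁ (ι₁ k)) (hF₂ : ∀ k, ι₃ (F₂ k) = f₂ (ι₂ k)) :
    Exact F₁ F₂ := by
  intro k₂
  constructor
  · intro hk
    have h0 : f₂ (ι₂ k₂) = 0 := by rw [← hF₂, hk, map_zero]
    obtain ⟨m, hm⟩ := (hf (ι₂ k₂)).mp h0
    have him : i₁ m = 0 := by
      apply hg₁
      rw [h₁, hm, map_zero]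
      exact (hι₂ (ι₂ k₂)).mpr ⟨k₂, rfl⟩
    obtain ⟨k₁, hk₁⟩ := (hι₁ m).mp him
    exact ⟨k₁, hι₂i (by rw [hF₁, hk₁, hm])⟩
  · rintro ⟨k₁, rfl⟩
    apply hι₃i
    rw [hF₂, hF₁, map_zero]
    exact hf.apply_apply_eq_zero (ι₁ k₁)

/-- Exactness of `coker i₁ → coker i₂ → coker i₃` (diagram chase; uses `f₂` surjective). [folklore] -/
theorem exact_cokerMap (hf₂ : Surjective f₂) (hg : Exact g₁ g₂) (h₂ : ∀ x, g₂ (i₂ x) = i₃ (f₂ x))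
    (hπ₂ : Exact i₂ π₂) (hπ₃ : Exact i₃ π₃) (hπ₁s : Surjective π₁) (hπ₂s : Surjective π₂)
    (hG₁ : ∀ n, G₁ (π₁ n) = π₂ (g₁ n)) (hG₂ : ∀ n, G₂ (π₂ n) = π₃ (g₂ n)) :
    Exact G₁ G₂ := by
  intro c₂
  constructor
  · intro hc
    obtain ⟨n₂, rfl⟩ := hπ₂s c₂
    rw [hG₂] at hc
    obtain ⟨m₃, hm₃⟩ := (hπ₃ (g₂ n₂)).mp hc
    obtain ⟨m₂, rfl⟩ := hf₂ m₃
    have h0 : g₂ (n₂ - i₂ m₂) = 0 := by rw [map_sub, h₂, hm₃, sub_self]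
    obtain ⟨n₁, hn₁⟩ := (hg _).mp h0
    refine ⟨π₁ n₁, ?_⟩
    rw [hG₁, hn₁, map_sub, hπ₂.apply_apply_eq_zero, sub_zero]
  · rintro ⟨c₁, rfl⟩
    obtain ⟨n₁, rfl⟩ := hπ₁s c₁
    rw [hG₁, hG₂, hg.apply_apply_eq_zero, map_zero]

/-- Exactness of `coker i₂ → coker i₃ → 0`: the map induced on cokernels by a surjective `g₂` is surjective. [folklore] -/
theorem surjective_cokerMap (hg₂ : Surjective g₂) (hπ₃s : Surjective π₃)
    (hG₂ : ∀ n, G₂ (π₂ n) = π₃ (g₂ n)) : Surjective G₂ := by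
  intro c₃
  obtain ⟨n₃, rfl⟩ := hπ₃s c₃
  obtain ⟨n₂, rfl⟩ := hg₂ n₃
  exact ⟨π₂ n₂, hG₂ n₂⟩

/-- **The six-term count.** For a commutative diagram of abelian groups with short exact rows
`0 → M₁ →f₁ M₂ →f₂ M₃ → 0`, `0 → N₁ →g₁ N₂ →g₂ N₃ → 0`, vertical maps `i₁, i₂, i₃`, kernels `ι_k : K_k ↪ M_k` and
cokernels `π_k : N_k ↠ C_k` of the `i_k` (presented by exactness), and the induced maps `F₁ : K₁ → K₂`, `F₂ : K₂ → K₃`,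
`G₁ : C₁ → C₂`, `G₂ : C₂ → C₃`: if the six corners are finite then
`#K₁ · #K₃ · #C₂ = #K₂ · #C₁ · #C₃` — the alternating product along the exact sequence
`0 → K₁ → K₂ → K₃ →δ C₁ → C₂ → C₃ → 0` (`δ` = Mathlib's `SnakeLemma.δ'`).
[cite: MilneADT2006, I §2 (Herbrand quotients)] -/
theorem natCard_snake (hf : Exact f₁ f₂) (hg : Exact g₁ g₂) (hf₁ : Injective f₁) (hf₂ : Surjective f₂)
    (hg₁ : Injective g₁) (hg₂ : Surjective g₂)
    (h₁ : ∀ x, g₁ (i₁ x) = i₂ (f₁ x)) (h₂ : ∀ x, g₂ (i₂ x) = i₃ (f₂ x))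
    (hι₁ : Exact ι₁ i₁) (hι₂ : Exact ι₂ i₂) (hι₃ : Exact ι₃ i₃)
    (hι₁i : Injective ι₁) (hι₂i : Injective ι₂) (hι₃i : Injective ι₃)
    (hπ₁ : Exact i₁ π₁) (hπ₂ : Exact i₂ π₂) (hπ₃ : Exact i₃ π₃)
    (hπ₁s : Surjective π₁) (hπ₂s : Surjective π₂) (hπ₃s : Surjective π₃)
    (hF₁ : ∀ k, ι₂ (F₁ k) = f₁ (ι₁ k)) (hF₂ : ∀ k, ι₃ (F₂ k) = f₂ (ι₂ k))
    (hG₁ : ∀ n, G₁ (π₁ n) = π₂ (g₁ n)) (hG₂ : ∀ n, G₂ (π₂ n) = π₃ (g₂ n))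
    [Finite K₁] [Finite K₂] [Finite K₃] [Finite C₁] [Finite C₂] [Finite C₃] :
    Nat.card K₁ * Nat.card K₃ * Nat.card C₂ = Nat.card K₂ * Nat.card C₁ * Nat.card C₃ := by
  -- ℤ-linear versions for Mathlib's snake lemma
  let f₁ₗ := f₁.toIntLinearMap
  let f₂ₗ := f₂.toIntLinearMap
  let g₁ₗ := g₁.toIntLinearMap
  let g₂ₗ := g₂.toIntLinearMap
  let i₁ₗ := i₁.toIntLinearMap
  let i₂ₗ := i₂.toIntLinearMap
  let i₃ₗ := i₃.toIntLinearMap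
  let ι₂ₗ := ι₂.toIntLinearMap
  let ι₃ₗ := ι₃.toIntLinearMap
  let π₁ₗ := π₁.toIntLinearMap
  let π₂ₗ := π₂.toIntLinearMap
  have hfₗ : Exact f₁ₗ f₂ₗ := hf
  have hgₗ : Exact g₁ₗ g₂ₗ := hg
  have h₁ₗ : g₁ₗ.comp i₁ₗ = i₂ₗ.comp f₁ₗ := LinearMap.ext fun x ↦ h₁ x
  have h₂ₗ : g₂ₗ.comp i₂ₗ = i₃ₗ.comp f₂ₗ := LinearMap.ext fun x ↦ h₂ x
  have hι₂ₗ : Exact ι₂ₗ i₂ₗ := hι₂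
  have hι₃ₗ : Exact ι₃ₗ i₃ₗ := hι₃
  have hπ₁ₗ : Exact i₁ₗ π₁ₗ := hπ₁
  have hπ₂ₗ : Exact i₂ₗ π₂ₗ := hπ₂
  have hf₂ₗ : Surjective f₂ₗ := hf₂
  have hg₁ₗ : Injective g₁ₗ := hg₁
  let F₂ₗ := F₂.toIntLinearMap
  let G₁ₗ := G₁.toIntLinearMap
  have hF₂ₗ : f₂ₗ.comp ι₂ₗ = ι₃ₗ.comp F₂ₗ := LinearMap.ext fun k ↦ (hF₂ k).symm
  have hG₁ₗ : G₁ₗ.comp π₁ₗ = π₂ₗ.comp g₁ₗ := LinearMap.ext fun n ↦ hG₁ n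
  -- the connecting homomorphism
  let δ : K₃ →ₗ[ℤ] C₁ :=
    SnakeLemma.δ' i₁ₗ i₂ₗ i₃ₗ f₁ₗ f₂ₗ hfₗ g₁ₗ g₂ₗ hgₗ h₁ₗ h₂ₗ ι₃ₗ hι₃ₗ π₁ₗ hπ₁ₗ hf₂ₗ hg₁ₗ
  have hδr : Exact F₂ δ.toAddMonoidHom :=
    SnakeLemma.exact_δ'_right i₁ₗ i₂ₗ i₃ₗ f₁ₗ f₂ₗ hfₗ g₁ₗ g₂ₗ hgₗ h₁ₗ h₂ₗ ι₂ₗ hι₂ₗ ι₃ₗ hι₃ₗ π₁ₗ hπ₁ₗ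
      hf₂ₗ hg₁ₗ F₂ₗ hF₂ₗ hι₃i
  have hδl : Exact δ.toAddMonoidHom G₁ :=
    SnakeLemma.exact_δ'_left i₁ₗ i₂ₗ i₃ₗ f₁ₗ f₂ₗ hfₗ g₁ₗ g₂ₗ hgₗ h₁ₗ h₂ₗ ι₃ₗ hι₃ₗ π₁ₗ hπ₁ₗ π₂ₗ hπ₂ₗ
      hf₂ₗ hg₁ₗ G₁ₗ hG₁ₗ hπ₁s
  -- the other exactness statements
  have e₁ : Injective F₁ := injective_kerMap hf₁ hι₁i hF₁
  have e₂ : Exact F₁ F₂ := exact_kerMap hf hg₁ h₁ hι₁ hι₂ hι₂i hι₃i hF₁ hF₂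
  have e₅ : Exact G₁ G₂ := exact_cokerMap hf₂ hg h₂ hπ₂ hπ₃ hπ₁s hπ₂s hG₁ hG₂
  have e₆ : Surjective G₂ := surjective_cokerMap hg₂ hπ₃s hG₂
  -- count
  have c₁ : Nat.card K₁ = Nat.card F₁.range := (natCard_range_of_injective F₁ e₁).symm
  have c₂ : Nat.card K₂ = Nat.card F₁.range * Nat.card F₂.range := natCard_eq_of_exact F₁ F₂ e₂
  have c₃ : Nat.card K₃ = Nat.card F₂.range * Nat.card δ.toAddMonoidHom.range :=
    natCard_eq_of_exact F₂ δ.toAddMonoidHom hδr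
  have c₄ : Nat.card C₁ = Nat.card δ.toAddMonoidHom.range * Nat.card G₁.range :=
    natCard_eq_of_exact δ.toAddMonoidHom G₁ hδl
  have c₅ : Nat.card C₂ = Nat.card G₁.range * Nat.card G₂.range := natCard_eq_of_exact G₁ G₂ e₅
  have c₆ : Nat.card C₃ = Nat.card G₂.range := (natCard_range_of_surjective G₂ e₆).symm
  rw [c₁, c₂, c₃, c₄, c₅, c₆]
  ring

end Snake

/-! ## §2 The quotient rule along surjections with finite kernels (road step (2)) -/

section Surjections

variable {X Y X' Y' : Type*} [AddCommGroup X] [AddCommGroup Y] [AddCommGroup X'] [AddCommGroup Y']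

/-- **Quotient rule.** Let `ρ : X → Y`, `ℓ : X' → Y'` be homomorphisms intertwined by SURJECTIONS `κ : X ↠ X'`,
`κ' : Y ↠ Y'` with finite kernels (`ℓ ∘ κ = κ' ∘ ρ`), and suppose `ρ, ℓ` have finite kernels and cokernels. Then
`#ker ρ · #coker ℓ · #ker κ' = #ker ℓ · #coker ρ · #ker κ`, i.e. `ind ℓ = ind ρ − d ker κ + d ker κ'`. (The six-term
count for the rows `0 → ker κ → X → X' → 0`, `0 → ker κ' → Y → Y' → 0`, combined with `#A = #ker · #im` for the map of
finite groups `ker κ → ker κ'`.) Used with `κ, κ'` the Kummer surjections `H¹(G, A[p]) ↠ H¹(G, A)[p]`.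
[cite: MilneADT2006, I §2 (Herbrand quotients)] -/
theorem natCard_ker_mul_of_surjective (ρ : X →+ Y) (ℓ : X' →+ Y') (κ : X →+ X') (κ' : Y →+ Y')
    (hκ : Surjective κ) (hκ' : Surjective κ') (hsq : ∀ x, ℓ (κ x) = κ' (ρ x))
    [Finite κ.ker] [Finite κ'.ker] [Finite ρ.ker] [Finite ℓ.ker] [Finite (Y ⧸ ρ.range)]
    [Finite (Y' ⧸ ℓ.range)] :
    Nat.card ρ.ker * Nat.card (Y' ⧸ ℓ.range) * Nat.card κ'.ker =
      Nat.card ℓ.ker * Nat.card (Y ⧸ ρ.range) * Nat.card κ.ker := by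
  classical
  -- the restriction `i₁ : ker κ → ker κ'` of `ρ`
  have hmem : ∀ x : κ.ker, ρ (x : X) ∈ κ'.ker := fun x ↦ by
    rw [AddMonoidHom.mem_ker, ← hsq, (AddMonoidHom.mem_ker).1 x.2, map_zero]
  let i₁ : κ.ker →+ κ'.ker := (ρ.comp κ.ker.subtype).codRestrict κ'.ker fun x ↦ hmem x
  have hi₁ : ∀ x : κ.ker, ((i₁ x : κ'.ker) : Y) = ρ x := fun _ ↦ rfl
  -- rows
  let f₁ : κ.ker →+ X := κ.ker.subtype
  let g₁ : κ'.ker →+ Y := κ'.ker.subtype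
  have hf : Exact f₁ κ := fun x ↦
    ⟨fun hx ↦ ⟨⟨x, hx⟩, rfl⟩, by rintro ⟨y, rfl⟩; exact y.2⟩
  have hg : Exact g₁ κ' := fun y ↦
    ⟨fun hy ↦ ⟨⟨y, hy⟩, rfl⟩, by rintro ⟨z, rfl⟩; exact z.2⟩
  -- kernels and cokernels of the three vertical maps
  let ι₁ : i₁.ker →+ κ.ker := i₁.ker.subtype
  let ι₂ : ρ.ker →+ X := ρ.ker.subtype
  let ι₃ : ℓ.ker →+ X' := ℓ.ker.subtype
  let π₁ : κ'.ker →+ κ'.ker ⧸ i₁.range := QuotientAddGroup.mk' i₁.range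
  let π₂ : Y →+ Y ⧸ ρ.range := QuotientAddGroup.mk' ρ.range
  let π₃ : Y' →+ Y' ⧸ ℓ.range := QuotientAddGroup.mk' ℓ.range
  -- induced maps
  let F₁ : i₁.ker →+ ρ.ker := (κ.ker.subtype.comp i₁.ker.subtype).codRestrict ρ.ker fun x ↦ by
    rw [AddMonoidHom.mem_ker]
    have hx := (AddMonoidHom.mem_ker).1 x.2
    change ρ ((x : κ.ker) : X) = 0
    rw [← hi₁, hx]; rfl
  let F₂ : ρ.ker →+ ℓ.ker := (κ.comp ρ.ker.subtype).codRestrict ℓ.ker fun x ↦ by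
    rw [AddMonoidHom.mem_ker, AddMonoidHom.comp_apply, hsq]
    change κ' (ρ (x : X)) = 0
    rw [(AddMonoidHom.mem_ker).1 x.2, map_zero]
  let G₁ : κ'.ker ⧸ i₁.range →+ Y ⧸ ρ.range := QuotientAddGroup.map i₁.range ρ.range g₁ (by
    rintro _ ⟨x, rfl⟩
    exact ⟨(x : X), (hi₁ x).symm⟩)
  let G₂ : Y ⧸ ρ.range →+ Y' ⧸ ℓ.range := QuotientAddGroup.map ρ.range ℓ.range κ' (by
    rintro _ ⟨x, rfl⟩
    exact ⟨κ x, hsq x⟩)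
  haveI : Finite i₁.ker := inferInstance
  haveI : Finite (κ'.ker ⧸ i₁.range) := inferInstance
  have hcount := natCard_snake (K₁ := i₁.ker) (K₂ := ρ.ker) (K₃ := ℓ.ker) (C₁ := κ'.ker ⧸ i₁.range)
    (C₂ := Y ⧸ ρ.range) (C₃ := Y' ⧸ ℓ.range) (f₁ := f₁) (f₂ := κ) (g₁ := g₁) (g₂ := κ') (i₁ := i₁)
    (i₂ := ρ) (i₃ := ℓ) (ι₁ := ι₁) (ι₂ := ι₂) (ι₃ := ι₃) (π₁ := π₁) (π₂ := π₂) (π₃ := π₃) (F₁ := F₁)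
    (F₂ := F₂) (G₁ := G₁) (G₂ := G₂) hf hg Subtype.val_injective hκ Subtype.val_injective hκ'
    (fun _ ↦ rfl) (fun x ↦ (hsq x).symm) (exact_ker_subtype i₁) (exact_ker_subtype ρ) (exact_ker_subtype ℓ) Subtype.val_injective
    Subtype.val_injective Subtype.val_injective (exact_mk'_range i₁) (exact_mk'_range ρ) (exact_mk'_range ℓ)
    (QuotientAddGroup.mk'_surjective _) (QuotientAddGroup.mk'_surjective _)
    (QuotientAddGroup.mk'_surjective _) (fun _ ↦ rfl) (fun _ ↦ rfl) (fun _ ↦ rfl) (fun _ ↦ rfl)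
  -- `#ker κ = #ker i₁ · #im i₁`, `#ker κ' = #im i₁ · #coker i₁`
  have hk : Nat.card κ.ker = Nat.card i₁.ker * Nat.card i₁.range :=
    Literature.NumberTheory.EllipticCurves.natCard_eq_card_ker_mul_card_range i₁
  have hk' : Nat.card κ'.ker = Nat.card i₁.range * Nat.card (κ'.ker ⧸ i₁.range) := by
    rw [mul_comm, AddSubgroup.card_eq_card_quotient_mul_card_addSubgroup i₁.range]
  have hpos : 0 < Nat.card i₁.range := Nat.card_pos
  have key : Nat.card ρ.ker * Nat.card (Y' ⧸ ℓ.range) * Nat.card κ'.ker * 1 =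
      Nat.card ℓ.ker * Nat.card (Y ⧸ ρ.range) * Nat.card κ.ker * 1 := by
    rw [hk, hk']
    calc Nat.card ρ.ker * Nat.card (Y' ⧸ ℓ.range) * (Nat.card i₁.range * Nat.card (κ'.ker ⧸ i₁.range)) * 1
        = (Nat.card ρ.ker * Nat.card (κ'.ker ⧸ i₁.range) * Nat.card (Y' ⧸ ℓ.range)) * Nat.card i₁.range := by
          ring
      _ = (Nat.card i₁.ker * Nat.card ℓ.ker * Nat.card (Y ⧸ ρ.range)) * Nat.card i₁.range := by
          rw [hcount]
      _ = Nat.card ℓ.ker * Nat.card (Y ⧸ ρ.range) * (Nat.card i₁.ker * Nat.card i₁.range) * 1 := by ring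
  simpa using key

end Surjections

end Summit.BirchSwinnertonDyer.BirchSwinnertonDyer.Theorems.FiniteIndexCalculus

end
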